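import Literature.MathematicalPhysics.KineticTheory.PostCollisionGeometry
import HarnessLib

/-!
# `DiffuseBackwardInfluence`, line `share-nondegeneracy-one-flight`: the cap/band geometry of share-degeneracy
(groundwork for the lever `ShareLD.ShareSetLD`, lead prover)

Crux `stmt-AtomisticToContinuum-12950` (`CollisionIsometryCLT.DiffuseBackwardInfluence`). The lever of the line says
that a particle's first collision after a slot boundary rarely hands over an `η`-DEGENERATE share `p = ⟨ω, Ĝ ω⟩ / tr Ĝ ∉ [η, 1−η]`
of a transfer block `Ĝ = M Mᵀ` (`M` with columns `u₀, u₁, u₂`, `tr Ĝ = Σ_a ‖u_a‖²`, `⟨ω, Ĝω⟩ = Σ_a ⟨ω, u_a⟩²`). This file proves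
the deterministic GEOMETRIC half of that statement, for an arbitrary real inner-product space `E`:

* `inner_sq_lt_of_share_lt` / `inner_sq_gt_of_share_gt` — the pigeonhole inclusions of the idea card (there proved in a
  Cruxes sketch, here landed): a LOW share (`< η·mass`) forces `⟨ω, û⟩² < 3η` and a HIGH share (`> (1−η)·mass`, `‖ω‖ ≤ 1`)
  forces `⟨ω, û⟩² > 1 − 3η`, where `û` is the direction of the LONGEST column;
* `abs_inner_lt_of_high` — a high share puts `ω` in the `√(3η)`-band of any unit `f ⊥ û` (Bessel);
* `degDir_subset_bands` — hence the set `degDir η u` of unit vectors `ω` along which the block `u` is `η`-share-degenerate lies in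
  the union of two equatorial bands of half-width `√(3η)` around past-determined directions (`û` and some `f ⊥ û`);
* `toSphere_degDir_le` — so its `μ.toSphere`-measure is `≤ 2·n·2^{n+3}·√(3η)·μ(B₁)` (`toSphere_band_le`), for EVERY nonzero block:
  degeneracy is an `O(√η)` condition on the normal, uniformly in the block;
* `toSphere_weightedDeg_le` — MARKOV OVER SOURCES: for weights `w_k ≥ 0` with `Σ_k w_k ≤ 1` vanishing on zero blocks, the set of
  `ω` whose weighted degeneracy score `Σ_k w_k·1[ω ∈ degDir η (U k)]` is `≥ δ` has measure `≤ δ⁻¹ · 2n2^{n+3}√(3η) μ(B₁)` — with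
  `w_k = a_ik/3` (row budget) this is exactly the score `degScore` of the line's vocabulary read as a function of the normal.

What remains for `ShareLD.ShareSetLD` after this file is purely dynamical: an `N`-uniform upper bound for the conditional law of
the realised normal given the coarse past (the one-flight lever), and the sequential product over a prescribed particle set.
-/

namespace Summit.AtomisticToContinuum.HydrodynamicLimit.Theorems.DiffuseBackwardInfluenceShare

namespace ShareLD

open scoped InnerProductSpace BigOperators ENNReal
open MeasureTheory Metric Set
open Literature.MathematicalPhysics.KineticTheory (toSphere_band_le inner_sq_add_inner_sq_le
  exists_norm_eq_one_inner_eq_zero)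

noncomputable section

section Algebra

variable {E : Type*} [NormedAddCommGroup E] [InnerProductSpace ℝ E]

omit [InnerProductSpace ℝ E] in
/-- The total mass of three columns is at most three times the largest column's. [folklore] -/
theorem sum_norm_sq_le_three_mul (u : Fin 3 → E) (a₀ : Fin 3) (hmax : ∀ a, ‖u a‖ ≤ ‖u a₀‖) :
    ∑ a, ‖u a‖ ^ 2 ≤ 3 * ‖u a₀‖ ^ 2 := by
  calc ∑ a, ‖u a‖ ^ 2 ≤ ∑ _a : Fin 3, ‖u a₀‖ ^ 2 :=
        Finset.sum_le_sum fun a _ => pow_le_pow_left₀ (norm_nonneg _) (hmax a) 2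
    _ = 3 * ‖u a₀‖ ^ 2 := by simp

/-- **LOW SHARE ⇒ BAND around the longest column** (pigeonhole): if `Σ_a ⟨ω, u_a⟩² < η Σ_a ‖u_a‖²` then
`⟨ω, u_{a₀}⟩² < 3η ‖u_{a₀}‖²` for the longest column `a₀`. [folklore] -/
theorem inner_sq_lt_of_share_lt (u : Fin 3 → E) (ω : E) {η : ℝ} (hη : 0 ≤ η) (a₀ : Fin 3)
    (hmax : ∀ a, ‖u a‖ ≤ ‖u a₀‖) (h : ∑ a, ⟪ω, u a⟫_ℝ ^ 2 < η * ∑ a, ‖u a‖ ^ 2) :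
    ⟪ω, u a₀⟫_ℝ ^ 2 < 3 * η * ‖u a₀‖ ^ 2 := by
  have h1 : ⟪ω, u a₀⟫_ℝ ^ 2 ≤ ∑ a, ⟪ω, u a⟫_ℝ ^ 2 :=
    Finset.single_le_sum (f := fun a => ⟪ω, u a⟫_ℝ ^ 2) (fun a _ => sq_nonneg _) (Finset.mem_univ a₀)
  have h2 : η * ∑ a, ‖u a‖ ^ 2 ≤ η * (3 * ‖u a₀‖ ^ 2) :=
    mul_le_mul_of_nonneg_left (sum_norm_sq_le_three_mul u a₀ hmax) hη
  linarith

/-- **HIGH SHARE ⇒ CAP around the longest column** (pigeonhole + Cauchy–Schwarz): if `‖ω‖ ≤ 1` and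
`(1−η) Σ_a ‖u_a‖² < Σ_a ⟨ω, u_a⟩²` then `(1 − 3η) ‖u_{a₀}‖² < ⟨ω, u_{a₀}⟩²` for the longest column `a₀`. [folklore] -/
theorem inner_sq_gt_of_share_gt (u : Fin 3 → E) {ω : E} (hω : ‖ω‖ ≤ 1) {η : ℝ} (hη : 0 ≤ η) (a₀ : Fin 3)
    (hmax : ∀ a, ‖u a‖ ≤ ‖u a₀‖) (h : (1 - η) * ∑ a, ‖u a‖ ^ 2 < ∑ a, ⟪ω, u a⟫_ℝ ^ 2) :
    (1 - 3 * η) * ‖u a₀‖ ^ 2 < ⟪ω, u a₀⟫_ℝ ^ 2 := by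
  -- each summand of the share is at most the corresponding mass
  have hcs : ∀ a, ⟪ω, u a⟫_ℝ ^ 2 ≤ ‖u a‖ ^ 2 := by
    intro a
    have h1 : |⟪ω, u a⟫_ℝ| ≤ ‖ω‖ * ‖u a‖ := abs_real_inner_le_norm _ _
    have h2 : ‖ω‖ * ‖u a‖ ≤ 1 * ‖u a‖ := mul_le_mul_of_nonneg_right hω (norm_nonneg _)
    rw [one_mul] at h2
    calc ⟪ω, u a⟫_ℝ ^ 2 = |⟪ω, u a⟫_ℝ| ^ 2 := (sq_abs _).symm
      _ ≤ ‖u a‖ ^ 2 := pow_le_pow_left₀ (abs_nonneg _) (h1.trans h2) 2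
  -- the deficit mass − share dominates its `a₀`-term
  have hdef : ‖u a₀‖ ^ 2 - ⟪ω, u a₀⟫_ℝ ^ 2 ≤ ∑ a, (‖u a‖ ^ 2 - ⟪ω, u a⟫_ℝ ^ 2) :=
    Finset.single_le_sum (f := fun a => ‖u a‖ ^ 2 - ⟪ω, u a⟫_ℝ ^ 2)
      (fun a _ => sub_nonneg.2 (hcs a)) (Finset.mem_univ a₀)
  rw [Finset.sum_sub_distrib] at hdef
  have h3 := sum_norm_sq_le_three_mul u a₀ hmax
  have hS0 : 0 ≤ ∑ a, ‖u a‖ ^ 2 := Finset.sum_nonneg fun a _ => sq_nonneg _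
  nlinarith

/-- A high share along a unit `û` puts `ω` (with `‖ω‖ ≤ 1`) in the `√(3η)`-band of every unit `f ⊥ û` (Bessel for the
orthonormal pair `(û, f)`). [folklore] -/
theorem inner_sq_lt_of_high {uhat f ω : E} (hu : ‖uhat‖ = 1) (hf : ‖f‖ = 1) (huf : ⟪uhat, f⟫_ℝ = 0)
    (hω : ‖ω‖ ≤ 1) {η : ℝ} (h : 1 - 3 * η < ⟪ω, uhat⟫_ℝ ^ 2) : ⟪ω, f⟫_ℝ ^ 2 < 3 * η := by
  have hb := inner_sq_add_inner_sq_le hu hf huf ω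
  have h1 : ‖ω‖ ^ 2 ≤ 1 := by
    calc ‖ω‖ ^ 2 ≤ 1 ^ 2 := pow_le_pow_left₀ (norm_nonneg _) hω 2
      _ = 1 := one_pow 2
  linarith

/-- `x² < c` with `0 ≤ c` gives `|x| < √c`. [folklore] -/
theorem abs_lt_sqrt_of_sq_lt {x c : ℝ} (h : x ^ 2 < c) : |x| < Real.sqrt c := by
  have hc : 0 ≤ c := (sq_nonneg x).trans h.le
  rw [← Real.sqrt_sq_eq_abs]
  exact Real.sqrt_lt_sqrt (sq_nonneg x) h

end Algebra

section Sphere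

variable {E : Type*} [NormedAddCommGroup E] [InnerProductSpace ℝ E]

/-- The set of unit vectors `ω` along which the block with columns `u` hands over an `η`-DEGENERATE share:
`Σ_a ⟨ω,u_a⟩² < η Σ_a ‖u_a‖²` (low) or `(1−η) Σ_a ‖u_a‖² < Σ_a ⟨ω,u_a⟩²` (high) — the predicate `Degenerate η mass share` of the
line's vocabulary read on the sphere. -/
def degDir (η : ℝ) (u : Fin 3 → E) : Set (sphere (0 : E) 1) :=
  {ω | ∑ a, ⟪(ω : E), u a⟫_ℝ ^ 2 < η * ∑ a, ‖u a‖ ^ 2 ∨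
    (1 - η) * ∑ a, ‖u a‖ ^ 2 < ∑ a, ⟪(ω : E), u a⟫_ℝ ^ 2}

/-- `degDir` is measurable (two strict inequalities between continuous functions). [folklore] -/
theorem measurableSet_degDir [MeasurableSpace E] [BorelSpace E] (η : ℝ) (u : Fin 3 → E) :
    MeasurableSet (degDir η u) := by
  have hc : Continuous fun ω : sphere (0 : E) 1 => ∑ a, ⟪(ω : E), u a⟫_ℝ ^ 2 :=
    continuous_finsetSum _ fun a _ => (continuous_subtype_val.inner continuous_const).pow 2
  exact (measurableSet_lt hc.measurable measurable_const).union
    (measurableSet_lt measurable_const hc.measurable)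

/-- **DEGENERATE DIRECTIONS LIE IN TWO BANDS.** For a nonzero block (`u a₀ ≠ 0` for the longest column `a₀`) and any unit `f`
orthogonal to `û = u_{a₀}/‖u_{a₀}‖`, every `ω ∈ degDir η u` has `|⟨ω, û⟩| < √(3η)` or `|⟨ω, f⟩| < √(3η)`. [folklore] -/
theorem degDir_subset_bands {η : ℝ} (hη : 0 ≤ η) (u : Fin 3 → E) (a₀ : Fin 3) (hmax : ∀ a, ‖u a‖ ≤ ‖u a₀‖)
    (h0 : u a₀ ≠ 0) {f : E} (hf : ‖f‖ = 1) (huf : ⟪‖u a₀‖⁻¹ • u a₀, f⟫_ℝ = 0) :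
    degDir η u ⊆ {ω | |⟪(ω : E), ‖u a₀‖⁻¹ • u a₀⟫_ℝ| < Real.sqrt (3 * η)} ∪
      {ω | |⟪(ω : E), f⟫_ℝ| < Real.sqrt (3 * η)} := by
  intro ω hω
  have hn : 0 < ‖u a₀‖ := norm_pos_iff.2 h0
  have hu1 : ‖‖u a₀‖⁻¹ • u a₀‖ = 1 := by
    rw [norm_smul, norm_inv, norm_norm, inv_mul_cancel₀ hn.ne']
  have hω1 : ‖(ω : E)‖ ≤ 1 := by simp
  -- ⟨ω, û⟩² = ⟨ω, u a₀⟩² / ‖u a₀‖²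
  have hsc : ⟪(ω : E), ‖u a₀‖⁻¹ • u a₀⟫_ℝ ^ 2 = ⟪(ω : E), u a₀⟫_ℝ ^ 2 / ‖u a₀‖ ^ 2 := by
    rw [real_inner_smul_right, mul_pow, inv_pow, div_eq_inv_mul]
  rcases hω with hlow | hhigh
  · left
    refine abs_lt_sqrt_of_sq_lt ?_
    have h1 := inner_sq_lt_of_share_lt u (ω : E) hη a₀ hmax hlow
    rw [hsc, div_lt_iff₀ (by positivity)]
    linarith
  · right
    refine abs_lt_sqrt_of_sq_lt (inner_sq_lt_of_high hu1 hf huf hω1 ?_)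
    have h1 := inner_sq_gt_of_share_gt u hω1 hη a₀ hmax hhigh
    rw [hsc, lt_div_iff₀ (by positivity)]
    linarith

variable [FiniteDimensional ℝ E] [MeasurableSpace E] [BorelSpace E]

/-- **THE MEASURE OF THE DEGENERATE DIRECTIONS IS `O(√η)`, UNIFORMLY IN THE BLOCK.** For `0 < η`, dimension `≥ 2` and a nonzero
block `u`, `μ.toSphere (degDir η u) ≤ 2·(n 2^{n+3} √(3η))·μ(B₁)`. [folklore] -/
theorem toSphere_degDir_le (μ : Measure E) [μ.IsAddHaarMeasure] {η : ℝ} (hη : 0 < η) (u : Fin 3 → E)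
    (hu : u ≠ 0) (h2 : 2 ≤ Module.finrank ℝ E) :
    μ.toSphere (degDir η u) ≤
      2 * (ENNReal.ofReal (Module.finrank ℝ E * (2 ^ (Module.finrank ℝ E + 3) * Real.sqrt (3 * η))) *
        μ (ball (0 : E) 1)) := by
  -- the longest column, nonzero
  obtain ⟨a₀, -, hmax⟩ := Finset.exists_max_image Finset.univ (fun a => ‖u a‖) Finset.univ_nonempty
  have hmax' : ∀ a, ‖u a‖ ≤ ‖u a₀‖ := fun a => hmax a (Finset.mem_univ a)
  have h0 : u a₀ ≠ 0 := by
    intro hz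
    apply hu
    funext a
    have : ‖u a‖ ≤ 0 := by simpa [hz] using hmax' a
    exact norm_le_zero_iff.1 this
  have hn : 0 < ‖u a₀‖ := norm_pos_iff.2 h0
  have hu1 : ‖‖u a₀‖⁻¹ • u a₀‖ = 1 := by
    rw [norm_smul, norm_inv, norm_norm, inv_mul_cancel₀ hn.ne']
  obtain ⟨f, hf, huf⟩ := exists_norm_eq_one_inner_eq_zero hu1 h2
  have hsub := degDir_subset_bands hη.le u a₀ hmax' h0 hf huf
  have hlam : 0 < Real.sqrt (3 * η) := Real.sqrt_pos.2 (by positivity)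
  have hm : 1 ≤ Module.finrank ℝ E := by omega
  calc μ.toSphere (degDir η u)
      ≤ μ.toSphere ({ω | |⟪(ω : E), ‖u a₀‖⁻¹ • u a₀⟫_ℝ| < Real.sqrt (3 * η)} ∪
          {ω | |⟪(ω : E), f⟫_ℝ| < Real.sqrt (3 * η)}) := measure_mono hsub
    _ ≤ μ.toSphere {ω | |⟪(ω : E), ‖u a₀‖⁻¹ • u a₀⟫_ℝ| < Real.sqrt (3 * η)} +
          μ.toSphere {ω | |⟪(ω : E), f⟫_ℝ| < Real.sqrt (3 * η)} := measure_union_le _ _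
    _ ≤ _ := by
        rw [two_mul]
        exact add_le_add (toSphere_band_le μ hu1 hlam hm) (toSphere_band_le μ hf hlam hm)

/-- **MARKOV OVER SOURCES.** For finitely many blocks `U k` with weights `0 ≤ w_k`, `Σ_k w_k ≤ 1`, vanishing on zero blocks,
the set of unit vectors whose weighted degeneracy score `Σ_k w_k·1[ω ∈ degDir η (U k)]` is at least `δ > 0` has
`μ.toSphere`-measure `≤ δ⁻¹ · 2 n 2^{n+3} √(3η) μ(B₁)` (with `w_k = a_ik/3` the score is the line's `degScore` read as a function of
the normal). [folklore] -/
theorem toSphere_weightedDeg_le (μ : Measure E) [μ.IsAddHaarMeasure] {η : ℝ} (hη : 0 < η)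
    (h2 : 2 ≤ Module.finrank ℝ E) {ι : Type*} (s : Finset ι) (U : ι → Fin 3 → E) (w : ι → ℝ)
    (hw0 : ∀ k ∈ s, 0 ≤ w k) (hw1 : ∑ k ∈ s, w k ≤ 1) (hwz : ∀ k ∈ s, U k = 0 → w k = 0) {δ : ℝ} (hδ : 0 < δ) :
    μ.toSphere {ω | δ ≤ ∑ k ∈ s, w k * (degDir η (U k)).indicator (fun _ => (1 : ℝ)) ω} ≤
      ENNReal.ofReal δ⁻¹ * (2 * (ENNReal.ofReal (Module.finrank ℝ E * (2 ^ (Module.finrank ℝ E + 3) *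
        Real.sqrt (3 * η))) * μ (ball (0 : E) 1))) := by
  classical
  set B : ℝ≥0∞ := 2 * (ENNReal.ofReal (Module.finrank ℝ E * (2 ^ (Module.finrank ℝ E + 3) *
        Real.sqrt (3 * η))) * μ (ball (0 : E) 1)) with hB
  -- the score as an `ℝ≥0∞`-valued measurable function
  have hfm : ∀ k ∈ s, Measurable fun ω : sphere (0 : E) 1 =>
      ENNReal.ofReal (w k) * (degDir η (U k)).indicator (fun _ => (1 : ℝ≥0∞)) ω :=
    fun k _ => measurable_const.mul (measurable_const.indicator (measurableSet_degDir η (U k)))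
  have hgm : Measurable fun ω : sphere (0 : E) 1 =>
      ∑ k ∈ s, ENNReal.ofReal (w k) * (degDir η (U k)).indicator (fun _ => (1 : ℝ≥0∞)) ω :=
    Finset.measurable_sum _ hfm
  -- the event is `{δ ≤ g}`
  have hsub : {ω : sphere (0 : E) 1 | δ ≤ ∑ k ∈ s, w k * (degDir η (U k)).indicator (fun _ => (1 : ℝ)) ω} ⊆
      {ω | ENNReal.ofReal δ ≤ ∑ k ∈ s, ENNReal.ofReal (w k) * (degDir η (U k)).indicator (fun _ => (1 : ℝ≥0∞)) ω} := by
    intro ω hω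
    simp only [Set.mem_setOf_eq] at hω ⊢
    have hnn : ∀ k ∈ s, 0 ≤ w k * (degDir η (U k)).indicator (fun _ => (1 : ℝ)) ω := by
      intro k hk
      refine mul_nonneg (hw0 k hk) ?_
      by_cases hmem : ω ∈ degDir η (U k)
      · simp [Set.indicator_of_mem hmem]
      · simp [Set.indicator_of_notMem hmem]
    have hterm : ∀ k ∈ s, ENNReal.ofReal (w k * (degDir η (U k)).indicator (fun _ => (1 : ℝ)) ω) =
        ENNReal.ofReal (w k) * (degDir η (U k)).indicator (fun _ => (1 : ℝ≥0∞)) ω := by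
      intro k hk
      by_cases hmem : ω ∈ degDir η (U k)
      · simp [Set.indicator_of_mem hmem]
      · simp [Set.indicator_of_notMem hmem]
    calc ENNReal.ofReal δ
        ≤ ENNReal.ofReal (∑ k ∈ s, w k * (degDir η (U k)).indicator (fun _ => (1 : ℝ)) ω) :=
          ENNReal.ofReal_le_ofReal hω
      _ = ∑ k ∈ s, ENNReal.ofReal (w k * (degDir η (U k)).indicator (fun _ => (1 : ℝ)) ω) :=
          ENNReal.ofReal_sum_of_nonneg hnn
      _ = _ := Finset.sum_congr rfl hterm
  -- Markov
  have hmarkov := mul_meas_ge_le_lintegral hgm (ENNReal.ofReal δ) (μ := μ.toSphere)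
  -- the integral of the score
  have hint : ∫⁻ ω, ∑ k ∈ s, ENNReal.ofReal (w k) * (degDir η (U k)).indicator (fun _ => (1 : ℝ≥0∞)) ω ∂μ.toSphere
      ≤ B := by
    rw [lintegral_finsetSum _ hfm]
    have h1 : ∀ k ∈ s, ∫⁻ ω, ENNReal.ofReal (w k) * (degDir η (U k)).indicator (fun _ => (1 : ℝ≥0∞)) ω ∂μ.toSphere
        = ENNReal.ofReal (w k) * μ.toSphere (degDir η (U k)) := by
      intro k _
      rw [lintegral_const_mul _ (measurable_const.indicator (measurableSet_degDir η (U k))),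
        lintegral_indicator_const (measurableSet_degDir η (U k)), one_mul]
    rw [Finset.sum_congr rfl h1]
    have h2 : ∀ k ∈ s, ENNReal.ofReal (w k) * μ.toSphere (degDir η (U k)) ≤ ENNReal.ofReal (w k) * B := by
      intro k hk
      by_cases hz : U k = 0
      · rw [hwz k hk hz, ENNReal.ofReal_zero, zero_mul, zero_mul]
      · gcongr
        exact toSphere_degDir_le μ hη (U k) hz h2
    calc ∑ k ∈ s, ENNReal.ofReal (w k) * μ.toSphere (degDir η (U k))
        ≤ ∑ k ∈ s, ENNReal.ofReal (w k) * B := Finset.sum_le_sum h2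
      _ = (∑ k ∈ s, ENNReal.ofReal (w k)) * B := by rw [Finset.sum_mul]
      _ ≤ 1 * B := by
          gcongr
          rw [← ENNReal.ofReal_sum_of_nonneg hw0, ← ENNReal.ofReal_one]
          exact ENNReal.ofReal_le_ofReal hw1
      _ = B := one_mul B
  -- divide by δ
  have hδ' : ENNReal.ofReal δ ≠ 0 := by simpa using hδ
  calc μ.toSphere {ω | δ ≤ ∑ k ∈ s, w k * (degDir η (U k)).indicator (fun _ => (1 : ℝ)) ω}
      ≤ μ.toSphere {ω | ENNReal.ofReal δ ≤
          ∑ k ∈ s, ENNReal.ofReal (w k) * (degDir η (U k)).indicator (fun _ => (1 : ℝ≥0∞)) ω} := measure_mono hsub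
    _ = (ENNReal.ofReal δ)⁻¹ * (ENNReal.ofReal δ * μ.toSphere {ω | ENNReal.ofReal δ ≤
          ∑ k ∈ s, ENNReal.ofReal (w k) * (degDir η (U k)).indicator (fun _ => (1 : ℝ≥0∞)) ω}) := by
        rw [← mul_assoc, ENNReal.inv_mul_cancel hδ' ENNReal.ofReal_ne_top, one_mul]
    _ ≤ (ENNReal.ofReal δ)⁻¹ * B := by gcongr; exact hmarkov.trans hint
    _ = ENNReal.ofReal δ⁻¹ * B := by rw [ENNReal.ofReal_inv_of_pos hδ]

end Sphere

end

end ShareLD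

noncomputable section

open scoped InnerProductSpace BigOperators ENNReal
open MeasureTheory Metric Set

/-- **REGISTERED SUB-GOAL — the cap/band Markov bound in the crux's own setting** (`ℝ³`, Lebesgue surface measure
`volume.toSphere` on `S²`, finitely many sources `k : Fin n` with blocks `U k : Fin 3 → ℝ³` and weights `w k`, e.g.
`w k = a_ik/3` under the row budget): the set of unit normals `ω` whose weighted share-degeneracy score is `≥ δ` has surface
measure `≤ δ⁻¹ · 2 · (3 · 2⁶ · √(3η)) · |B₁|` — an `O(√η/δ)` fraction of the sphere, uniformly in the blocks. [folklore] -/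
theorem volume_toSphere_weightedDeg_le : ∀ (η δ : ℝ), 0 < η → 0 < δ → ∀ (n : ℕ) (U : Fin n → Fin 3 → EuclideanSpace ℝ (Fin 3)) (w : Fin n → ℝ), (∀ k, 0 ≤ w k) → ∑ k, w k ≤ 1 → (∀ k, U k = 0 → w k = 0) → (volume : Measure (EuclideanSpace ℝ (Fin 3))).toSphere {ω | δ ≤ ∑ k, w k * (ShareLD.degDir η (U k)).indicator (fun _ => (1 : ℝ)) ω} ≤ ENNReal.ofReal δ⁻¹ * (2 * (ENNReal.ofReal (3 * (2 ^ 6 * Real.sqrt (3 * η))) * volume (Metric.ball (0 : EuclideanSpace ℝ (Fin 3)) 1))) := by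
  intro η δ hη hδ n U w hw0 hw1 hwz
  have h3 : Module.finrank ℝ (EuclideanSpace ℝ (Fin 3)) = 3 := finrank_euclideanSpace_fin
  have h := ShareLD.toSphere_weightedDeg_le (volume : Measure (EuclideanSpace ℝ (Fin 3))) hη
    (by rw [h3]; norm_num) Finset.univ U w (fun k _ => hw0 k) hw1 (fun k _ => hwz k) hδ
  rw [h3] at h
  norm_num at h ⊢
  exact h

end

end Summit.AtomisticToContinuum.HydrodynamicLimit.Theorems.DiffuseBackwardInfluenceShare
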